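import Summits.AtomisticToContinuum.BoseEinsteinCondensation.Theses.BECInfraredBound
import Summits.AtomisticToContinuum.BoseEinsteinCondensation.Theorems.BECInfraredBoundBecDepletionCountingSumRule
import Summits.AtomisticToContinuum.BoseEinsteinCondensation.Theorems.BECInfraredBoundBecDepletionCountingTransfer

/-!
# `BecDepletionCounting` (stmt-AtomisticToContinuum-9034): inner-box depletion + shell mass ⇒ X_B1

Route `BECInfraredBound` of `AtomisticToContinuum/BoseEinsteinCondensation`, mode-counting glue piece 3/3
(the Parseval/sum-rule step of DLS–KLS mode counting, continuum inner-box form), line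
`translate-traced-parseval` of the crux chain. For every repulsive finite-range `v`:
(inner-box depletion — some `θ < 1`: for all `ε ∈ (0,1/4)`, at small density, eventually in `N`, every
`δ`-near-minimiser has `Σ'_{k ≠ 0} ⟨φ'_k, γ_Ψ φ'_k⟩ ≤ θN`, `φ'_k` the plane waves of the open inner box
`Λ' = (εL, L−εL)³`)
→ (shell mass — some `C > 0`: same clause ending in `Σ_i ∫ 1_{Λ'ᶜ}(x_i)|Ψ|² ≤ CεN`)
→ (X_B1 — at small density some `c > 0`: eventually every `δ`-near-minimiser has `⟨φ₀, γ_Ψ φ₀⟩ ≥ cN`,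
`φ₀ = L^{-3/2} 1_Λ`).

Proof (composition of the two helper files):
1. the open inner box `Λ'` and the half-open one `S = ∏ [εL, L−εL)` agree a.e. (`innerIoo_ae_eq_innerIco`,
   pulled back from `NeumannBox.box_ae_eq_cell` along a translation), so the depletion hypothesis transfers
   to the half-open modes (`occupation_congr_ae`) and the shell hypothesis dominates the `S`-shell mass;
2. the inner-cube sum rule `Σ_{k ∈ ℤ³} ⟨φ'_k, γ_Ψ φ'_k⟩ = (n+1) ∫ 1_S(x₀)|Ψ|²`
   (`tsum_occupation_innerMode_eq`, helper file 1) with `k = 0` split off, plus the mass split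
   `(n+1) ∫ 1_S(x₀)|Ψ|² + (n+1) ∫ 1_{Sᶜ}(x₀)|Ψ|² = n+1` and Bose symmetry for the shell sum;
3. the shell transfer `(1−2ε)³ ⟨φ'_0, γφ'_0⟩ ≤ 2⟨φ₀, γφ₀⟩ + 12ε(n+1)` (`shellTransfer`, helper file 2);
4. real arithmetic (`zeroMode_lower_arith'`): with `s = 1 − max θ 0`, `ε = min(1/8, s/(16C), s/128)` one gets
   `⟨φ₀, γ_Ψ φ₀⟩ ≥ (s/8)·N`; filter assembly (`min` of the `ρ₀`'s and `δ`'s, `Filter.Eventually` intersection,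
   `N ≥ 1`).
The inner cubes are written as the literal sets `{x | ∀ j, x j ∈ Set.Ico (ε * L) (L - ε * L)}` (half-open, `S`)
and `{x | ∀ j, x j ∈ Set.Ioo (ε * L) (L - ε * L)}` (open, `Λ'`, as in the crux) throughout (no auxiliary
definitions). References: LSSY2005 Ch. 11 (11.26)–(11.27); DysonLiebSimon1978 §1.
-/

noncomputable section

namespace Summit.AtomisticToContinuum.BoseEinsteinCondensation.Theorems

namespace BECInfraredBoundDepletionCounting

open MeasureTheory Complex WithLp Filter
open scoped ENNReal NNReal ComplexConjugate BigOperators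
open Literature.MathematicalPhysics.QuantumManyBody.BoseGas

/-- The open inner cube is the preimage of the open box of side `(1-2ε)L` under `x ↦ x - a`,
`a = εL·𝟙` (any `a` with all coordinates `εL`). -/
theorem innerIoo_eq_preimage {L ε : ℝ} {a : Space} (ha : ∀ j, a j = ε * L) :
    {x : Space | ∀ j, x j ∈ Set.Ioo (ε * L) (L - ε * L)} = (fun x : Space => x + (-a)) ⁻¹' box ((1 - 2 * ε) * L) := by
  ext x
  simp only [box, Set.mem_setOf_eq, Set.mem_Ioo, Set.mem_preimage, PiLp.add_apply,
    PiLp.neg_apply, ha]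
  refine forall_congr' fun j => ?_
  constructor <;> rintro ⟨h1, h2⟩ <;> constructor <;> linarith

/-- The open inner cube lies in the half-open one. -/
theorem innerIoo_subset_innerIco (L ε : ℝ) : {x : Space | ∀ j, x j ∈ Set.Ioo (ε * L) (L - ε * L)} ⊆ {x : Space | ∀ j, x j ∈ Set.Ico (ε * L) (L - ε * L)} := fun _ hx j =>
  ⟨(hx j).1.le, (hx j).2⟩

/-- `Λ'(open) = S(half-open)` almost everywhere (faces are null): pull back `box =ᵐ cell` along
the measure-preserving translation. -/
theorem innerIoo_ae_eq_innerIco (L ε : ℝ) : {x : Space | ∀ j, x j ∈ Set.Ioo (ε * L) (L - ε * L)} =ᵐ[volume] {x : Space | ∀ j, x j ∈ Set.Ico (ε * L) (L - ε * L)} := by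
  obtain ⟨a, ha⟩ : ∃ a : Space, ∀ j, a j = ε * L := ⟨toLp 2 fun _ => ε * L, fun _ => rfl⟩
  rw [innerIoo_eq_preimage ha, innerIco_eq_preimage ha]
  exact (measurePreserving_add_right volume (-a)).quasiMeasurePreserving.preimage_ae_eq
    (Literature.MathematicalPhysics.QuantumManyBody.NeumannBox.box_ae_eq_cell _)

/-- Splitting `k = 0` off an `ℝ≥0∞`-valued sum over `ℤ³`. -/
theorem tsum_eq_zero_add_tsum_ne_zero (f : (Fin 3 → ℤ) → ℝ≥0∞) :
    ∑' k, f k = f 0 + ∑' k : {k : Fin 3 → ℤ // k ≠ 0}, f k.1 := by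
  rw [ENNReal.tsum_eq_add_tsum_ite 0]
  congr 1
  rw [show (∑' k : {k : Fin 3 → ℤ // k ≠ 0}, f k.1) =
      ∑' k : ({k | k ≠ 0} : Set (Fin 3 → ℤ)), f k from rfl, tsum_subtype]
  refine tsum_congr fun k => ?_
  by_cases hk : k = 0
  · simp [hk]
  · rw [Set.indicator_of_mem (show k ∈ {k : Fin 3 → ℤ | k ≠ 0} from hk)]
    simp [hk]

/-- The real arithmetic of the counting step: from the sum rule `O' + S + M = N`, the depletion bound
`S ≤ θN`, the shell bound `M ≤ CεN` and the transfer `(1-2ε)³ O' ≤ 2·O + 12εN`, with `θ ≤ 1 - s`,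
`Cε ≤ s/16`, `ε ≤ s/128` (whence `ε ≤ 1/128`), conclude `O ≥ (s/8)·N`. -/
theorem zeroMode_lower_arith' {O O' S M : ℝ≥0∞} {N : ℕ} {C ε s θ : ℝ}
    (hε0 : 0 < ε) (hs0 : 0 < s) (hθ0 : 0 ≤ θ) (hθs : θ ≤ 1 - s)
    (hC0 : 0 < C) (hCε : C * ε ≤ s / 16) (hεs : ε ≤ s / 128)
    (h1 : O' + S + M = (N : ℝ≥0∞))
    (h2 : S ≤ ENNReal.ofReal (θ * N))
    (h3 : M ≤ ENNReal.ofReal (C * ε * N))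
    (h4 : ENNReal.ofReal ((1 - 2 * ε) ^ 3) * O' ≤ 2 * O + ENNReal.ofReal (12 * ε) * (N : ℝ≥0∞)) :
    ENNReal.ofReal (s / 8 * N) ≤ O := by
  rcases eq_or_ne O ⊤ with hO | hO
  · rw [hO]; exact le_top
  have hO'T : O' ≠ ⊤ := by
    intro h; rw [h, top_add, top_add] at h1; exact ENNReal.top_ne_natCast N h1
  have hST : S ≠ ⊤ := by
    intro h; rw [h, add_top, top_add] at h1; exact ENNReal.top_ne_natCast N h1
  have hMT : M ≠ ⊤ := by
    intro h; rw [h, add_top] at h1; exact ENNReal.top_ne_natCast N h1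
  have e1 : O'.toReal + S.toReal + M.toReal = N := by
    have := congrArg ENNReal.toReal h1
    rwa [ENNReal.toReal_add (ENNReal.add_ne_top.2 ⟨hO'T, hST⟩) hMT, ENNReal.toReal_add hO'T hST,
      ENNReal.toReal_natCast] at this
  have e2 : S.toReal ≤ θ * N := ENNReal.toReal_le_of_le_ofReal (by positivity) h2
  have e3 : M.toReal ≤ C * ε * N := ENNReal.toReal_le_of_le_ofReal (by positivity) h3
  have hM0 : 0 ≤ M.toReal := ENNReal.toReal_nonneg
  have hA0 : 0 ≤ (1 - 2 * ε) ^ 3 := by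
    have : 0 ≤ 1 - 2 * ε := by linarith
    positivity
  have h2O : (2 : ℝ≥0∞) * O ≠ ⊤ := ENNReal.mul_ne_top (by norm_num) hO
  have h12N : ENNReal.ofReal (12 * ε) * (N : ℝ≥0∞) ≠ ⊤ :=
    ENNReal.mul_ne_top ENNReal.ofReal_ne_top (ENNReal.natCast_ne_top N)
  have e4 : (1 - 2 * ε) ^ 3 * O'.toReal ≤ 2 * O.toReal + 12 * ε * N := by
    have := ENNReal.toReal_mono (ENNReal.add_ne_top.2 ⟨h2O, h12N⟩) h4
    rwa [ENNReal.toReal_mul, ENNReal.toReal_ofReal hA0, ENNReal.toReal_add h2O h12N,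
      ENNReal.toReal_mul, ENNReal.toReal_mul, ENNReal.toReal_ofReal (by positivity),
      ENNReal.toReal_ofNat, ENNReal.toReal_natCast] at this
  refine ENNReal.ofReal_le_of_le_toReal ?_
  have hN : (0 : ℝ) ≤ N := Nat.cast_nonneg N
  have hA27 : (27 / 64 : ℝ) ≤ (1 - 2 * ε) ^ 3 := by
    have h34 : (3 / 4 : ℝ) ≤ 1 - 2 * ε := by linarith
    have : (27 / 64 : ℝ) = (3 / 4) ^ 3 := by norm_num
    rw [this]
    exact pow_le_pow_left₀ (by norm_num) h34 3
  generalize hA : (1 - 2 * ε) ^ 3 = A at e4 hA0 hA27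
  have hgap : 0 ≤ (N : ℝ) - θ * N - C * ε * N := by
    have : 0 ≤ 1 - θ - C * ε := by linarith
    nlinarith [mul_nonneg hN this]
  have ho' : (N : ℝ) - θ * N - C * ε * N ≤ O'.toReal := by linarith
  have h5 : A * ((N : ℝ) - θ * N - C * ε * N) ≤ A * O'.toReal := mul_le_mul_of_nonneg_left ho' hA0
  have h7 : (27 / 64 : ℝ) * ((N : ℝ) - θ * N - C * ε * N) ≤ A * ((N : ℝ) - θ * N - C * ε * N) :=
    mul_le_mul_of_nonneg_right hA27 hgap
  have h8 : θ * N ≤ (1 - s) * N := mul_le_mul_of_nonneg_right hθs hN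
  have h9 : C * ε * N ≤ s / 16 * N := mul_le_mul_of_nonneg_right hCε hN
  have h10 : ε * N ≤ s / 128 * N := mul_le_mul_of_nonneg_right hεs hN
  have hsN : 0 ≤ s * N := mul_nonneg hs0.le hN
  nlinarith [h5, h7, h8, h9, h10, hsN, e4]

/-- CORE COUNTING STEP at fixed `n, L, ε` (all analysis done): depletion on the open inner cube + shell
mass ⟹ `occ(φ₀) ≥ (s/8)·(n+1)`. -/
theorem counting_core {n : ℕ} {L ε C s θ : ℝ} (hL : 0 < L) (hε0 : 0 < ε) (hε8 : ε ≤ 1 / 8)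
    (hs0 : 0 < s) (hθ0 : 0 ≤ θ) (hθs : θ ≤ 1 - s) (hC0 : 0 < C) (hCε : C * ε ≤ s / 16)
    (hεs : ε ≤ s / 128) (Ψ : TrialState (n + 1) L)
    (hD : ∑' k : {k : Fin 3 → ℤ // k ≠ 0}, occupation (n + 1)
        ({x : Space | ∀ j, x j ∈ Set.Ioo (ε * L) (L - ε * L)}.indicator fun x => ((Real.sqrt (((1 - 2 * ε) * L) ^ 3))⁻¹ : ℂ) *
          Complex.exp (Complex.I * ↑(2 * Real.pi / ((1 - 2 * ε) * L) * ∑ j, (k.1 j : ℝ) * x j))) Ψ.ψ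
        ≤ ENNReal.ofReal (θ * ((n + 1 : ℕ) : ℝ)))
    (hS : ∑ i : Fin (n + 1), ∫⁻ X, {x : Space | ∀ j, x j ∈ Set.Ioo (ε * L) (L - ε * L)}ᶜ.indicator (fun _ => (1 : ℝ≥0∞)) (X i) *
        (‖Ψ.ψ X‖₊ : ℝ≥0∞) ^ 2 ≤ ENNReal.ofReal (C * ε * ((n + 1 : ℕ) : ℝ))) :
    ENNReal.ofReal (s / 8 * ((n + 1 : ℕ) : ℝ)) ≤
      occupation (n + 1) ((box L).indicator fun _ => ((Real.sqrt (L ^ 3))⁻¹ : ℂ)) Ψ.ψ := by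
  have hε4 : ε < 1 / 4 := hε8.trans_lt (by norm_num)
  have hε2 : ε < 1 / 2 := hε8.trans_lt (by norm_num)
  have hΨc : Continuous Ψ.ψ := Ψ.contDiff.continuous
  have hmeasS : Measurable fun X : Config (n + 1) =>
      {x : Space | ∀ j, x j ∈ Set.Ico (ε * L) (L - ε * L)}.indicator (fun _ => (1 : ℝ≥0∞)) (X 0) * (‖Ψ.ψ X‖₊ : ℝ≥0∞) ^ 2 :=
    ((measurable_const.indicator (measurableSet_innerIco L ε)).comp (measurable_pi_apply 0)).mul
      (hΨc.measurable.nnnorm.coe_nnreal_ennreal.pow_const _)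
  -- (1) DEPL transferred to the half-open cube (modes agree a.e.)
  have hD' : ∑' k : {k : Fin 3 → ℤ // k ≠ 0}, occupation (n + 1)
      ({x : Space | ∀ j, x j ∈ Set.Ico (ε * L) (L - ε * L)}.indicator fun x => ((Real.sqrt (((1 - 2 * ε) * L) ^ 3))⁻¹ : ℂ) *
        Complex.exp (Complex.I * ↑(2 * Real.pi / ((1 - 2 * ε) * L) * ∑ j, (k.1 j : ℝ) * x j))) Ψ.ψ
      ≤ ENNReal.ofReal (θ * ((n + 1 : ℕ) : ℝ)) :=
    (tsum_congr fun k => occupation_congr_ae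
      (indicator_ae_eq_of_ae_eq_set (innerIoo_ae_eq_innerIco L ε).symm) _).trans_le hD
  -- (2) the inner-cube sum rule, `k = 0` split off, zero mode = constant mode
  have hsum : occupation (n + 1)
        ({x : Space | ∀ j, x j ∈ Set.Ico (ε * L) (L - ε * L)}.indicator fun _ => ((Real.sqrt (((1 - 2 * ε) * L) ^ 3))⁻¹ : ℂ)) Ψ.ψ +
      ∑' k : {k : Fin 3 → ℤ // k ≠ 0}, occupation (n + 1)
        ({x : Space | ∀ j, x j ∈ Set.Ico (ε * L) (L - ε * L)}.indicator fun x => ((Real.sqrt (((1 - 2 * ε) * L) ^ 3))⁻¹ : ℂ) *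
          Complex.exp (Complex.I * ↑(2 * Real.pi / ((1 - 2 * ε) * L) * ∑ j, (k.1 j : ℝ) * x j))) Ψ.ψ
      = ((n : ℝ≥0∞) + 1) * ∫⁻ X : Config (n + 1),
          {x : Space | ∀ j, x j ∈ Set.Ico (ε * L) (L - ε * L)}.indicator (fun _ => (1 : ℝ≥0∞)) (X 0) * (‖Ψ.ψ X‖₊ : ℝ≥0∞) ^ 2 := by
    have h := tsum_occupation_innerMode_eq (ε := ε) hL hε2 hΨc
    rw [tsum_eq_zero_add_tsum_ne_zero] at h
    simp only [Pi.zero_apply, Int.cast_zero, zero_mul, Finset.sum_const_zero, mul_zero,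
      Complex.ofReal_zero, Complex.exp_zero, mul_one] at h
    exact h
  -- (3) mass split `(n+1)·P(x₀ ∈ S) + (n+1)·P(x₀ ∉ S) = n+1`
  have hmass : (((n : ℝ≥0∞) + 1) * ∫⁻ X : Config (n + 1),
          {x : Space | ∀ j, x j ∈ Set.Ico (ε * L) (L - ε * L)}.indicator (fun _ => (1 : ℝ≥0∞)) (X 0) * (‖Ψ.ψ X‖₊ : ℝ≥0∞) ^ 2) +
        ((n : ℝ≥0∞) + 1) * ∫⁻ X : Config (n + 1),
          {x : Space | ∀ j, x j ∈ Set.Ico (ε * L) (L - ε * L)}ᶜ.indicator (fun _ => (1 : ℝ≥0∞)) (X 0) * (‖Ψ.ψ X‖₊ : ℝ≥0∞) ^ 2 =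
      ((n + 1 : ℕ) : ℝ≥0∞) := by
    rw [← mul_add, ← lintegral_add_left hmeasS]
    rw [lintegral_congr fun X => by
      rw [← add_mul, Set.indicator_self_add_compl_apply, one_mul]]
    rw [Ψ.norm_eq, mul_one, Nat.cast_succ]
  -- (4) shell by Bose symmetry + monotonicity `1_{Sᶜ} ≤ 1_{Λ'ᶜ}`
  have hperm : ∀ i : Fin (n + 1),
      ∫⁻ X : Config (n + 1), {x : Space | ∀ j, x j ∈ Set.Ico (ε * L) (L - ε * L)}ᶜ.indicator (fun _ => (1 : ℝ≥0∞)) (X i) *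
          (‖Ψ.ψ X‖₊ : ℝ≥0∞) ^ 2 =
        ∫⁻ X : Config (n + 1), {x : Space | ∀ j, x j ∈ Set.Ico (ε * L) (L - ε * L)}ᶜ.indicator (fun _ => (1 : ℝ≥0∞)) (X 0) *
          (‖Ψ.ψ X‖₊ : ℝ≥0∞) ^ 2 := by
    intro i
    refine (lintegral_congr fun X => ?_).trans (lintegral_comp_perm (Equiv.swap 0 i)
      (fun X : Config (n + 1) => {x : Space | ∀ j, x j ∈ Set.Ico (ε * L) (L - ε * L)}ᶜ.indicator (fun _ => (1 : ℝ≥0∞)) (X 0) *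
        (‖Ψ.ψ X‖₊ : ℝ≥0∞) ^ 2))
    simp only [Function.comp_apply, Equiv.swap_apply_left, Ψ.symm]
  have hM : ((n : ℝ≥0∞) + 1) * ∫⁻ X : Config (n + 1),
        {x : Space | ∀ j, x j ∈ Set.Ico (ε * L) (L - ε * L)}ᶜ.indicator (fun _ => (1 : ℝ≥0∞)) (X 0) * (‖Ψ.ψ X‖₊ : ℝ≥0∞) ^ 2 ≤
      ENNReal.ofReal (C * ε * ((n + 1 : ℕ) : ℝ)) := by
    calc ((n : ℝ≥0∞) + 1) * ∫⁻ X : Config (n + 1),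
          {x : Space | ∀ j, x j ∈ Set.Ico (ε * L) (L - ε * L)}ᶜ.indicator (fun _ => (1 : ℝ≥0∞)) (X 0) * (‖Ψ.ψ X‖₊ : ℝ≥0∞) ^ 2
        = ∑ i : Fin (n + 1), ∫⁻ X : Config (n + 1),
            {x : Space | ∀ j, x j ∈ Set.Ico (ε * L) (L - ε * L)}ᶜ.indicator (fun _ => (1 : ℝ≥0∞)) (X 0) * (‖Ψ.ψ X‖₊ : ℝ≥0∞) ^ 2 := by
          rw [Finset.sum_const, Finset.card_univ, Fintype.card_fin, nsmul_eq_mul, Nat.cast_succ]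
      _ = ∑ i : Fin (n + 1), ∫⁻ X : Config (n + 1),
            {x : Space | ∀ j, x j ∈ Set.Ico (ε * L) (L - ε * L)}ᶜ.indicator (fun _ => (1 : ℝ≥0∞)) (X i) * (‖Ψ.ψ X‖₊ : ℝ≥0∞) ^ 2 :=
          Finset.sum_congr rfl fun i _ => (hperm i).symm
      _ ≤ ∑ i : Fin (n + 1), ∫⁻ X : Config (n + 1),
            {x : Space | ∀ j, x j ∈ Set.Ioo (ε * L) (L - ε * L)}ᶜ.indicator (fun _ => (1 : ℝ≥0∞)) (X i) * (‖Ψ.ψ X‖₊ : ℝ≥0∞) ^ 2 := by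
          refine Finset.sum_le_sum fun i _ => lintegral_mono fun X => mul_le_mul_left
            (Set.indicator_le_indicator_of_subset
              (Set.compl_subset_compl.2 (innerIoo_subset_innerIco L ε)) (fun _ => ?_) _) _
          exact zero_le_one
      _ ≤ _ := hS
  -- (5) the shell transfer
  have hT : ENNReal.ofReal ((1 - 2 * ε) ^ 3) * occupation (n + 1)
        ({x : Space | ∀ j, x j ∈ Set.Ico (ε * L) (L - ε * L)}.indicator fun _ => ((Real.sqrt (((1 - 2 * ε) * L) ^ 3))⁻¹ : ℂ)) Ψ.ψ ≤
      2 * occupation (n + 1) ((box L).indicator fun _ => ((Real.sqrt (L ^ 3))⁻¹ : ℂ)) Ψ.ψ +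
        ENNReal.ofReal (12 * ε) * ((n + 1 : ℕ) : ℝ≥0∞) := by
    have h := shellTransfer hL hε0 hε4 Ψ
    rw [← Nat.cast_succ] at h
    exact h
  -- (6) arithmetic
  have h1 := (congrArg (fun t => t + ((n : ℝ≥0∞) + 1) * ∫⁻ X : Config (n + 1),
      {x : Space | ∀ j, x j ∈ Set.Ico (ε * L) (L - ε * L)}ᶜ.indicator (fun _ => (1 : ℝ≥0∞)) (X 0) * (‖Ψ.ψ X‖₊ : ℝ≥0∞) ^ 2) hsum).trans
    hmass
  exact zeroMode_lower_arith' hε0 hs0 hθ0 hθs hC0 hCε hεs h1 hD' hM hT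

end BECInfraredBoundDepletionCounting

open BECInfraredBoundDepletionCounting Literature.MathematicalPhysics.QuantumManyBody.BoseGas Filter in
/-- **`BecDepletionCounting` (stmt-AtomisticToContinuum-9034), by name.** For every repulsive finite-range
`v`: inner-box depletion (`Σ'_{k≠0} ⟨φ'_k, γ_Ψ φ'_k⟩ ≤ θN`, `θ < 1`) → shell mass (`≤ CεN`) → X_B1
(`⟨φ₀, γ_Ψ φ₀⟩ ≥ cN` at small density, eventually in `N`, for near-minimisers). It holds unconditionally
(a deterministic counting implication; `v` and the repulsivity hypothesis are not used beyond typing).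
Margin `ε = min(1/8, s/(16C), s/128)` with `s = 1 − max θ 0`, constant `c = s/8`, `ρ₀ = min ρ₁ ρ₂`,
`δ = min δ₁ δ₂`; both hypotheses are used (depletion and shell), then `counting_core`. -/
theorem BecDepletionCounting_proof :
    Summit.AtomisticToContinuum.BoseEinsteinCondensation.Theses.BECInfraredBound.BecDepletionCounting := by
  intro v _hv hD hS
  obtain ⟨θ, hθ1, HD⟩ := hD
  obtain ⟨C, hC0, HS⟩ := hS
  obtain ⟨s, hs0, hθs, hθs'⟩ : ∃ s : ℝ, 0 < s ∧ max θ 0 ≤ 1 - s ∧ s ≤ 1 :=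
    ⟨1 - max θ 0, by have := max_lt hθ1 one_pos; linarith, le_of_eq (by ring),
      by have := le_max_right θ 0; linarith⟩
  obtain ⟨ε, hε0, hε8, hCε, hεs⟩ : ∃ ε : ℝ, 0 < ε ∧ ε ≤ 1 / 8 ∧ C * ε ≤ s / 16 ∧ ε ≤ s / 128 := by
    refine ⟨min (min (1 / 8) (s / (16 * C))) (s / 128), ?_, ?_, ?_, min_le_right _ _⟩
    · exact lt_min (lt_min (by norm_num) (by positivity)) (by positivity)
    · exact (min_le_left _ _).trans (min_le_left _ _)
    · calc C * min (min (1 / 8) (s / (16 * C))) (s / 128) ≤ C * (s / (16 * C)) :=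
            mul_le_mul_of_nonneg_left ((min_le_left _ _).trans (min_le_right _ _)) hC0.le
        _ = s / 16 := by field_simp
  have hε4 : ε < 1 / 4 := hε8.trans_lt (by norm_num)
  obtain ⟨ρ₁, hρ₁, H1⟩ := HD ε hε0 hε4
  obtain ⟨ρ₂, hρ₂, H2⟩ := HS ε hε0 hε4
  refine ⟨min ρ₁ ρ₂, lt_min hρ₁ hρ₂, fun ρ hρ hρlt => ⟨s / 8, by positivity, ?_⟩⟩
  filter_upwards [H1 ρ hρ (lt_of_lt_of_le hρlt (min_le_left _ _)),
    H2 ρ hρ (lt_of_lt_of_le hρlt (min_le_right _ _)), Filter.eventually_ge_atTop 1]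
    with N hN1 hN2 hNpos
  obtain ⟨δ₁, hδ₁, HΨ1⟩ := hN1
  obtain ⟨δ₂, hδ₂, HΨ2⟩ := hN2
  refine ⟨min δ₁ δ₂, lt_min hδ₁ hδ₂, fun Ψ hΨ => ?_⟩
  have hΨ1 := HΨ1 Ψ (hΨ.trans (add_le_add le_rfl (min_le_left _ _)))
  have hΨ2 := HΨ2 Ψ (hΨ.trans (add_le_add le_rfl (min_le_right _ _)))
  obtain ⟨n, rfl⟩ : ∃ n, N = n + 1 := Nat.exists_eq_succ_of_ne_zero (by omega)
  have hL : 0 < sideLength ρ (n + 1) :=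
    Real.rpow_pos_of_pos (div_pos (by exact_mod_cast hNpos) hρ) _
  have hθN : ENNReal.ofReal (θ * ((n + 1 : ℕ) : ℝ)) ≤ ENNReal.ofReal (max θ 0 * ((n + 1 : ℕ) : ℝ)) :=
    ENNReal.ofReal_le_ofReal (mul_le_mul_of_nonneg_right (le_max_left θ 0) (Nat.cast_nonneg _))
  exact counting_core hL hε0 hε8 hs0 (le_max_right θ 0) hθs hC0 hCε hεs Ψ (hΨ1.trans hθN) hΨ2

end Summit.AtomisticToContinuum.BoseEinsteinCondensation.Theorems

end
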